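import Literature.Computability.AlgebraicComplexity.QuantumFunctionalsProofs
import Literature.Computability.AlgebraicComplexity.QuantumFunctionalsDegenerationProofs
import HarnessLib

/-!
# Quantum functionals and the Kronecker product: super-multiplicativity (CVZ Lemma 3.23)

Topic: `Literature/Computability/AlgebraicComplexity`; proof file next to `QuantumFunctionals.lean`
for the named fact `ChristandlVranaZuiddam2023_kronecker` (CVZ Cor. 3.31:
`F^θ(s ⊗ t) = F^θ(s) F^θ(t)` for the quantum functional of complex 3-tensors).

## Content

The tree's `quantumFunctional θ` is the *lower* quantum functional `F_θ` of
Christandl–Vrana–Zuiddam (Def. 3.16: `F_θ(t) = 2^{E_θ(t)}`,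
`E_θ(t) = sup_{(A,B,C) ∈ GL × GL × GL} H_θ((A ⊗ B ⊗ C)·t)`). Multiplicativity of `F_θ` under the
tensor (Kronecker) product (Cor. 3.31) is the conjunction of

* **super-multiplicativity** `F_θ(s ⊗ t) ≥ F_θ(s) F_θ(t)` (Thm. 3.19.3 = Lemma 3.23), which is
  elementary: the quantum marginals of `s ⊗ t` are the Kronecker products of those of `s` and `t`,
  von Neumann entropy is additive on tensor products, and `(A ⊗ A') ⊗ (B ⊗ B') ⊗ (C ⊗ C')` acts on
  `s ⊗ t` factorwise; and
* **sub-multiplicativity** `F_θ(s ⊗ t) ≤ F_θ(s) F_θ(t)`, which in the source goes through the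
  *upper* quantum functional `F^θ` defined by isotypic projectors of Schur–Weyl duality (Def. 3.3):
  `F^θ` is sub-multiplicative (Lemma 3.13, from the semigroup property of Kronecker coefficients and
  the entropy inequality `g_{λμν} ≠ 0 ⇒ H(λ̄) ≤ H(μ̄) + H(ν̄)`, Lemma 3.10), `F^θ ≥ F_θ` (Thm. 3.24,
  Keyl–Werner spectrum estimation + gentle measurement) and `F^θ = F_θ` for `θ ∈ P_s(B)` (Thm. 3.30,
  entanglement-polytope characterisation Thm. 3.29).

This file PROVES the first half for `k = 3`:

* `kroneckerTensor` bookkeeping: `actTensor_kronecker_kroneckerTensor` (the action is factorwise),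
  `tensorNormSq_kroneckerTensor`, `reducedDensity₁/₂/₃_kroneckerTensor` (marginals of `s ⊗ t` are
  `ρ_j(s) ⊗ₖ ρ_j(t)`), `kroneckerTensor_ne_zero` (the composition law `actTensor_actTensor` and
  `actTensor_ne_zero_of_ne_zero` are imported from `QuantumFunctionalsDegenerationProofs.lean`,
  `reducedDensity₂/₃_apply` from `QuantumFunctionalsProofs.lean`).
* `charpoly_kronecker_of_isHermitian` / `sum_map_eigenvalues_kronecker`: the spectrum of `A ⊗ₖ B`
  for Hermitian `A, B` is the multiset of products of eigenvalues (via the spectral theorem and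
  `charpoly`), in the symmetric-function form `∑ₚ F(eig(A ⊗ₖ B)ₚ) = ∑_{i,j} F(eig(A)ᵢ eig(B)ⱼ)`.
* `shannonEntropy_mul_eq`: Shannon entropy is additive on product distributions;
  `quantumEntropy_kroneckerTensor`: `H_θ(s ⊗ t) = H_θ(s) + H_θ(t)` for `s, t ≠ 0`.
* `logQuantumFunctional_add_le_kroneckerTensor`: `E_θ(s) + E_θ(t) ≤ E_θ(s ⊗ t)`;
  `ChristandlVranaZuiddam2023_kronecker_ge`: `F^θ(s) F^θ(t) ≤ F^θ(s ⊗ t)` for all `θ ∈ P([3])` and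
  all complex 3-tensors `s, t` (CVZ Thm. 3.19.3).

The second half is NOT proved here (it needs Schur–Weyl duality, Kronecker coefficients, spectrum
estimation and moment polytopes, none of which is in Mathlib); see `NOTES.md` of the fact's unit
for the decomposition plan.

## Source

M. Christandl, P. Vrana, J. Zuiddam, *Universal points in the asymptotic spectrum of tensors*,
J. Amer. Math. Soc. 36 (2023) 31–79 = arXiv:1709.07851v3: Def. 3.16, Thm. 3.19, Lemma 3.23
(p. 15), Cor. 3.31 (p. 16).
-/

noncomputable section

open scoped BigOperators Matrix ComplexOrder Kronecker
open Real (negMulLog)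
open Polynomial (X C)

namespace Literature.Computability.AlgebraicComplexity

universe u

/-! ## Kronecker products of coordinate tensors: bookkeeping -/

section KroneckerBasics

variable {K : Type*} [CommSemiring K]
variable {ι κ μ ι' κ' μ' : Type*}

/-- `0 ⊗ t = 0`. [folklore] -/
@[simp] theorem kroneckerTensor_zero_left (t : ι' → κ' → μ' → K) :
    kroneckerTensor (0 : ι → κ → μ → K) t = 0 := by
  funext a b c
  simp [kroneckerTensor]

/-- `s ⊗ 0 = 0`. [folklore] -/
@[simp] theorem kroneckerTensor_zero_right (s : ι → κ → μ → K) :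
    kroneckerTensor s (0 : ι' → κ' → μ' → K) = 0 := by
  funext a b c
  simp [kroneckerTensor]

/-- Over a field (no zero divisors), `s ⊗ t ≠ 0` for `s, t ≠ 0`. [folklore] -/
theorem kroneckerTensor_ne_zero {L : Type*} [CommSemiring L] [NoZeroDivisors L]
    {s : ι → κ → μ → L} {t : ι' → κ' → μ' → L} (hs : s ≠ 0) (ht : t ≠ 0) :
    kroneckerTensor s t ≠ 0 := by
  obtain ⟨a, ha⟩ := Function.ne_iff.1 hs
  obtain ⟨b, hb⟩ := Function.ne_iff.1 ha
  obtain ⟨c, hc⟩ := Function.ne_iff.1 hb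
  obtain ⟨a', ha'⟩ := Function.ne_iff.1 ht
  obtain ⟨b', hb'⟩ := Function.ne_iff.1 ha'
  obtain ⟨c', hc'⟩ := Function.ne_iff.1 hb'
  intro h
  have := congr_fun (congr_fun (congr_fun h (a, a')) (b, b')) (c, c')
  simp only [kroneckerTensor_apply, Pi.zero_apply, mul_eq_zero] at this
  exact this.elim hc hc'

variable [Fintype ι] [Fintype κ] [Fintype μ] [Fintype ι'] [Fintype κ'] [Fintype μ']

/-- **The action is factorwise on Kronecker products**:
`((A ⊗ A') ⊗ (B ⊗ B') ⊗ (C ⊗ C'))·(s ⊗ t) = ((A ⊗ B ⊗ C)·s) ⊗ ((A' ⊗ B' ⊗ C')·t)`.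
[folklore] -/
theorem actTensor_kronecker_kroneckerTensor {ι₂ κ₂ μ₂ ι₂' κ₂' μ₂' : Type*}
    (A : Matrix ι₂ ι K) (B : Matrix κ₂ κ K) (C : Matrix μ₂ μ K)
    (A' : Matrix ι₂' ι' K) (B' : Matrix κ₂' κ' K) (C' : Matrix μ₂' μ' K)
    (s : ι → κ → μ → K) (t : ι' → κ' → μ' → K) :
    actTensor (A ⊗ₖ A') (B ⊗ₖ B') (C ⊗ₖ C') (kroneckerTensor s t) =
      kroneckerTensor (actTensor A B C s) (actTensor A' B' C' t) := by
  funext a b c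
  simp only [actTensor_apply, kroneckerTensor_apply, Matrix.kroneckerMap_apply,
    Fintype.sum_prod_type]
  -- right-hand side: expand the product of two triple sums step by step
  rw [Finset.sum_mul_sum]
  refine Finset.sum_congr rfl fun x _ => Finset.sum_congr rfl fun x' _ => ?_
  rw [Finset.sum_mul_sum]
  refine Finset.sum_congr rfl fun y _ => Finset.sum_congr rfl fun y' _ => ?_
  rw [Finset.sum_mul_sum]
  refine Finset.sum_congr rfl fun z _ => Finset.sum_congr rfl fun z' _ => ?_
  ring

end KroneckerBasics

/-! ## Norms and quantum marginals of Kronecker products -/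

section KroneckerMarginals

variable {ι κ μ ι' κ' μ' : Type*} [Fintype ι] [Fintype κ] [Fintype μ] [Fintype ι'] [Fintype κ']
  [Fintype μ']

/-- `⟨s ⊗ t | s ⊗ t⟩ = ⟨s|s⟩ ⟨t|t⟩`. [folklore] -/
theorem tensorNormSq_kroneckerTensor (s : ι → κ → μ → ℂ) (t : ι' → κ' → μ' → ℂ) :
    tensorNormSq (kroneckerTensor s t) = tensorNormSq s * tensorNormSq t := by
  simp only [tensorNormSq, kroneckerTensor_apply, Fintype.sum_prod_type, norm_mul, mul_pow]
  rw [Finset.sum_mul_sum]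
  refine Finset.sum_congr rfl fun a _ => Finset.sum_congr rfl fun a' _ => ?_
  rw [Finset.sum_mul_sum]
  refine Finset.sum_congr rfl fun b _ => Finset.sum_congr rfl fun b' _ => ?_
  rw [Finset.sum_mul_sum]

omit [Fintype ι] [Fintype ι'] in
/-- **First marginal of a tensor product**: `|s ⊗ t⟩⟨s ⊗ t|₁ = |s⟩⟨s|₁ ⊗ₖ |t⟩⟨t|₁`
(CVZ, proof of Lemma 3.23: "the reduced states are related as `ρ^{s⊗t}_S = ρ^s_S ⊗ ρ^t_S`").
[cite: ChristandlVranaZuiddam2023, Lemma 3.23] -/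
theorem reducedDensity₁_kroneckerTensor (s : ι → κ → μ → ℂ) (t : ι' → κ' → μ' → ℂ) :
    reducedDensity₁ (kroneckerTensor s t) = reducedDensity₁ s ⊗ₖ reducedDensity₁ t := by
  ext ⟨a, a'⟩ ⟨d, d'⟩
  simp only [reducedDensity₁_apply, Matrix.kroneckerMap_apply, kroneckerTensor_apply,
    Fintype.sum_prod_type, star_mul']
  rw [Finset.sum_mul_sum]
  refine Finset.sum_congr rfl fun b _ => Finset.sum_congr rfl fun b' _ => ?_
  rw [Finset.sum_mul_sum]
  refine Finset.sum_congr rfl fun c _ => Finset.sum_congr rfl fun c' _ => ?_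
  ring

omit [Fintype κ] [Fintype κ'] in
/-- **Second marginal of a tensor product**: `|s ⊗ t⟩⟨s ⊗ t|₂ = |s⟩⟨s|₂ ⊗ₖ |t⟩⟨t|₂`.
[cite: ChristandlVranaZuiddam2023, Lemma 3.23] -/
theorem reducedDensity₂_kroneckerTensor (s : ι → κ → μ → ℂ) (t : ι' → κ' → μ' → ℂ) :
    reducedDensity₂ (kroneckerTensor s t) = reducedDensity₂ s ⊗ₖ reducedDensity₂ t := by
  ext ⟨b, b'⟩ ⟨d, d'⟩
  simp only [reducedDensity₂_apply, Matrix.kroneckerMap_apply, kroneckerTensor_apply,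
    Fintype.sum_prod_type, star_mul']
  rw [Finset.sum_mul_sum]
  refine Finset.sum_congr rfl fun a _ => Finset.sum_congr rfl fun a' _ => ?_
  rw [Finset.sum_mul_sum]
  refine Finset.sum_congr rfl fun c _ => Finset.sum_congr rfl fun c' _ => ?_
  ring

omit [Fintype μ] [Fintype μ'] in
/-- **Third marginal of a tensor product**: `|s ⊗ t⟩⟨s ⊗ t|₃ = |s⟩⟨s|₃ ⊗ₖ |t⟩⟨t|₃`.
[cite: ChristandlVranaZuiddam2023, Lemma 3.23] -/
theorem reducedDensity₃_kroneckerTensor (s : ι → κ → μ → ℂ) (t : ι' → κ' → μ' → ℂ) :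
    reducedDensity₃ (kroneckerTensor s t) = reducedDensity₃ s ⊗ₖ reducedDensity₃ t := by
  ext ⟨c, c'⟩ ⟨d, d'⟩
  simp only [reducedDensity₃_apply, Matrix.kroneckerMap_apply, kroneckerTensor_apply,
    Fintype.sum_prod_type, star_mul']
  rw [Finset.sum_mul_sum]
  refine Finset.sum_congr rfl fun a _ => Finset.sum_congr rfl fun a' _ => ?_
  rw [Finset.sum_mul_sum]
  refine Finset.sum_congr rfl fun b _ => Finset.sum_congr rfl fun b' _ => ?_
  ring

end KroneckerMarginals

/-! ## The spectrum of a Kronecker product of Hermitian matrices -/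

section Spectrum

variable {m n : Type*} [Fintype m] [Fintype n] [DecidableEq m] [DecidableEq n]

/-- The roots of `∏ᵢ (X - f i)` are the multiset of values of `f`. [folklore] -/
theorem roots_prod_X_sub_C_eq_map {R : Type*} [CommRing R] [IsDomain R] {σ : Type*}
    (S : Finset σ) (f : σ → R) : (∏ i ∈ S, (X - C (f i))).roots = S.val.map f := by
  have h : ∏ i ∈ S, (X - C (f i)) = ((S.val.map f).map fun a => X - C a).prod := by
    rw [Finset.prod_eq_multiset_prod, Multiset.map_map]
    rfl
  rw [h, Polynomial.roots_multiset_prod_X_sub_C]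

/-- The spectral theorem in the form `A = U diag(λ) U⋆` with `U` the eigenvector unitary.
[folklore] -/
theorem eq_eigenvectorUnitary_mul_diagonal_of_isHermitian {A : Matrix m m ℂ}
    (hA : A.IsHermitian) :
    A = (hA.eigenvectorUnitary : Matrix m m ℂ) * Matrix.diagonal (fun i => (hA.eigenvalues i : ℂ)) *
      star (hA.eigenvectorUnitary : Matrix m m ℂ) := by
  conv_lhs => rw [hA.spectral_theorem, Unitary.conjStarAlgAut_apply]
  rfl

/-- **Characteristic polynomial of a Kronecker product of Hermitian matrices**:
`χ_{A ⊗ B} = ∏_{i,j} (X - λᵢ(A) λⱼ(B))` (simultaneous unitary diagonalisation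
`A ⊗ B = (U ⊗ V)(D_A ⊗ D_B)(U ⊗ V)⋆`). [folklore] -/
theorem charpoly_kronecker_of_isHermitian {A : Matrix m m ℂ} {B : Matrix n n ℂ}
    (hA : A.IsHermitian) (hB : B.IsHermitian) :
    (A ⊗ₖ B).charpoly =
      ∏ p : m × n, (X - C ((hA.eigenvalues p.1 * hB.eigenvalues p.2 : ℝ) : ℂ)) := by
  have hUA : star (hA.eigenvectorUnitary : Matrix m m ℂ) * (hA.eigenvectorUnitary : Matrix m m ℂ) =
      1 := Unitary.star_mul_self_of_mem hA.eigenvectorUnitary.prop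
  have hUB : star (hB.eigenvectorUnitary : Matrix n n ℂ) * (hB.eigenvectorUnitary : Matrix n n ℂ) =
      1 := Unitary.star_mul_self_of_mem hB.eigenvectorUnitary.prop
  conv_lhs => rw [eq_eigenvectorUnitary_mul_diagonal_of_isHermitian hA,
    eq_eigenvectorUnitary_mul_diagonal_of_isHermitian hB]
  rw [Matrix.mul_kronecker_mul, Matrix.mul_kronecker_mul, Matrix.charpoly_mul_comm,
    ← Matrix.mul_assoc, ← Matrix.mul_kronecker_mul, hUA, hUB, Matrix.one_kronecker_one,
    Matrix.one_mul, Matrix.diagonal_kronecker_diagonal, Matrix.charpoly_diagonal]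
  simp only [Complex.ofReal_mul]

/-- **Spectrum of a Kronecker product**: for Hermitian `A`, `B` and `M = A ⊗ₖ B`, the eigenvalues of
`M` (with multiplicity) are the products `λᵢ(A) λⱼ(B)`; stated through symmetric functions:
`∑ₚ F(λₚ(M)) = ∑_{i,j} F(λᵢ(A) λⱼ(B))` for every `F`. [folklore] -/
theorem sum_map_eigenvalues_kronecker {A : Matrix m m ℂ} {B : Matrix n n ℂ} (hA : A.IsHermitian)
    (hB : B.IsHermitian) {M : Matrix (m × n) (m × n) ℂ} (hM : M.IsHermitian) (hMAB : M = A ⊗ₖ B)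
    {γ : Type*} [AddCommMonoid γ] (F : ℝ → γ) :
    ∑ p, F (hM.eigenvalues p) = ∑ p : m × n, F (hA.eigenvalues p.1 * hB.eigenvalues p.2) := by
  subst hMAB
  have hr1 : (A ⊗ₖ B).charpoly.roots =
      (Finset.univ : Finset (m × n)).val.map fun p => (hM.eigenvalues p : ℂ) := by
    rw [hM.charpoly_eq, roots_prod_X_sub_C_eq_map]
    rfl
  have hr2 : (A ⊗ₖ B).charpoly.roots = (Finset.univ : Finset (m × n)).val.map
      fun p : m × n => ((hA.eigenvalues p.1 * hB.eigenvalues p.2 : ℝ) : ℂ) := by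
    rw [charpoly_kronecker_of_isHermitian hA hB, roots_prod_X_sub_C_eq_map]
  have hr : (Finset.univ : Finset (m × n)).val.map (fun p => hM.eigenvalues p) =
      (Finset.univ : Finset (m × n)).val.map
        fun p : m × n => hA.eigenvalues p.1 * hB.eigenvalues p.2 := by
    have h := congr_arg (Multiset.map Complex.re) (hr1.symm.trans hr2)
    simpa only [Multiset.map_map, Function.comp_def, Complex.ofReal_re] using h
  calc ∑ p, F (hM.eigenvalues p)
      = (((Finset.univ : Finset (m × n)).val.map fun p => hM.eigenvalues p).map F).sum := by
        rw [Finset.sum_eq_multiset_sum, Multiset.map_map]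
        rfl
    _ = (((Finset.univ : Finset (m × n)).val.map
          fun p : m × n => hA.eigenvalues p.1 * hB.eigenvalues p.2).map F).sum := by rw [hr]
    _ = ∑ p : m × n, F (hA.eigenvalues p.1 * hB.eigenvalues p.2) := by
        rw [Finset.sum_eq_multiset_sum, Multiset.map_map]
        rfl

end Spectrum

/-! ## Additivity of entropies on tensor products -/

section Entropy

variable {m n : Type*} [Fintype m] [Fintype n]

/-- `-∑_{i,j} pᵢqⱼ log(pᵢqⱼ) = -∑ᵢ pᵢ log pᵢ - ∑ⱼ qⱼ log qⱼ` for `∑ p = ∑ q = 1`: Shannon entropy is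
additive on product distributions. [folklore] -/
theorem sum_negMulLog_mul_eq {p : m → ℝ} {q : n → ℝ} (hp : ∑ i, p i = 1) (hq : ∑ j, q j = 1) :
    ∑ x : m × n, negMulLog (p x.1 * q x.2) = ∑ i, negMulLog (p i) + ∑ j, negMulLog (q j) := by
  have h1 : ∑ i, ∑ j, q j * negMulLog (p i) = ∑ i, negMulLog (p i) := by
    refine Finset.sum_congr rfl fun i _ => ?_
    rw [← Finset.sum_mul, hq, one_mul]
  have h2 : ∑ i, ∑ j, p i * negMulLog (q j) = ∑ j, negMulLog (q j) := by
    simp_rw [← Finset.mul_sum]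
    rw [← Finset.sum_mul, hp, one_mul]
  calc ∑ x : m × n, negMulLog (p x.1 * q x.2)
      = ∑ i, ∑ j, (q j * negMulLog (p i) + p i * negMulLog (q j)) := by
        simp only [Fintype.sum_prod_type, Real.negMulLog_mul]
    _ = ∑ i, ∑ j, q j * negMulLog (p i) + ∑ i, ∑ j, p i * negMulLog (q j) := by
        simp only [Finset.sum_add_distrib]
    _ = ∑ i, negMulLog (p i) + ∑ j, negMulLog (q j) := by rw [h1, h2]

/-- Shannon entropy (bits) is additive on product distributions: `H(p ⊗ q) = H(p) + H(q)`.
[folklore] -/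
theorem shannonEntropy_mul_eq {p : m → ℝ} {q : n → ℝ} (hp : ∑ i, p i = 1) (hq : ∑ j, q j = 1) :
    shannonEntropy (fun x : m × n => p x.1 * q x.2) = shannonEntropy p + shannonEntropy q := by
  rw [shannonEntropy_def, shannonEntropy_def, shannonEntropy_def, ← add_div,
    sum_negMulLog_mul_eq hp hq]

variable {ι κ μ ι' κ' μ' : Type*} [Fintype ι] [Fintype κ] [Fintype μ] [Fintype ι'] [Fintype κ']
  [Fintype μ'] [DecidableEq ι] [DecidableEq κ] [DecidableEq μ] [DecidableEq ι'] [DecidableEq κ']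
  [DecidableEq μ']

omit [DecidableEq κ] [DecidableEq μ] [DecidableEq κ'] [DecidableEq μ'] in
/-- `H(r₁(s ⊗ t)) = H(r₁(s)) + H(r₁(t))` for `s, t ≠ 0`.
[cite: ChristandlVranaZuiddam2023, Lemma 3.23] -/
theorem shannonEntropy_marginalSpectrum₁_kroneckerTensor {s : ι → κ → μ → ℂ}
    {t : ι' → κ' → μ' → ℂ} (hs : s ≠ 0) (ht : t ≠ 0) :
    shannonEntropy (marginalSpectrum₁ (kroneckerTensor s t)) =
      shannonEntropy (marginalSpectrum₁ s) + shannonEntropy (marginalSpectrum₁ t) := by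
  rw [← shannonEntropy_mul_eq (marginalSpectrum₁_mem_stdSimplex hs).2
    (marginalSpectrum₁_mem_stdSimplex ht).2, shannonEntropy_def, shannonEntropy_def]
  congr 1
  have h := sum_map_eigenvalues_kronecker (isHermitian_reducedDensity₁ s)
    (isHermitian_reducedDensity₁ t) (isHermitian_reducedDensity₁ (kroneckerTensor s t))
    (reducedDensity₁_kroneckerTensor s t)
    (fun x => negMulLog (x / tensorNormSq (kroneckerTensor s t)))
  simp only [marginalSpectrum₁]
  rw [h]
  refine Finset.sum_congr rfl fun x _ => ?_
  rw [tensorNormSq_kroneckerTensor, mul_div_mul_comm]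

omit [DecidableEq ι] [DecidableEq μ] [DecidableEq ι'] [DecidableEq μ'] in
/-- `H(r₂(s ⊗ t)) = H(r₂(s)) + H(r₂(t))` for `s, t ≠ 0`.
[cite: ChristandlVranaZuiddam2023, Lemma 3.23] -/
theorem shannonEntropy_marginalSpectrum₂_kroneckerTensor {s : ι → κ → μ → ℂ}
    {t : ι' → κ' → μ' → ℂ} (hs : s ≠ 0) (ht : t ≠ 0) :
    shannonEntropy (marginalSpectrum₂ (kroneckerTensor s t)) =
      shannonEntropy (marginalSpectrum₂ s) + shannonEntropy (marginalSpectrum₂ t) := by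
  rw [← shannonEntropy_mul_eq (marginalSpectrum₂_mem_stdSimplex hs).2
    (marginalSpectrum₂_mem_stdSimplex ht).2, shannonEntropy_def, shannonEntropy_def]
  congr 1
  have h := sum_map_eigenvalues_kronecker (isHermitian_reducedDensity₂ s)
    (isHermitian_reducedDensity₂ t) (isHermitian_reducedDensity₂ (kroneckerTensor s t))
    (reducedDensity₂_kroneckerTensor s t)
    (fun x => negMulLog (x / tensorNormSq (kroneckerTensor s t)))
  simp only [marginalSpectrum₂]
  rw [h]
  refine Finset.sum_congr rfl fun x _ => ?_
  rw [tensorNormSq_kroneckerTensor, mul_div_mul_comm]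

omit [DecidableEq ι] [DecidableEq κ] [DecidableEq ι'] [DecidableEq κ'] in
/-- `H(r₃(s ⊗ t)) = H(r₃(s)) + H(r₃(t))` for `s, t ≠ 0`.
[cite: ChristandlVranaZuiddam2023, Lemma 3.23] -/
theorem shannonEntropy_marginalSpectrum₃_kroneckerTensor {s : ι → κ → μ → ℂ}
    {t : ι' → κ' → μ' → ℂ} (hs : s ≠ 0) (ht : t ≠ 0) :
    shannonEntropy (marginalSpectrum₃ (kroneckerTensor s t)) =
      shannonEntropy (marginalSpectrum₃ s) + shannonEntropy (marginalSpectrum₃ t) := by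
  rw [← shannonEntropy_mul_eq (marginalSpectrum₃_mem_stdSimplex hs).2
    (marginalSpectrum₃_mem_stdSimplex ht).2, shannonEntropy_def, shannonEntropy_def]
  congr 1
  have h := sum_map_eigenvalues_kronecker (isHermitian_reducedDensity₃ s)
    (isHermitian_reducedDensity₃ t) (isHermitian_reducedDensity₃ (kroneckerTensor s t))
    (reducedDensity₃_kroneckerTensor s t)
    (fun x => negMulLog (x / tensorNormSq (kroneckerTensor s t)))
  simp only [marginalSpectrum₃]
  rw [h]
  refine Finset.sum_congr rfl fun x _ => ?_
  rw [tensorNormSq_kroneckerTensor, mul_div_mul_comm]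

/-- **`H_θ(s ⊗ t) = H_θ(s) + H_θ(t)`** for nonzero `s, t` (CVZ, proof of Lemma 3.23).
[cite: ChristandlVranaZuiddam2023, Lemma 3.23] -/
theorem quantumEntropy_kroneckerTensor (θ : Fin 3 → ℝ) {s : ι → κ → μ → ℂ} {t : ι' → κ' → μ' → ℂ}
    (hs : s ≠ 0) (ht : t ≠ 0) :
    quantumEntropy θ (kroneckerTensor s t) = quantumEntropy θ s + quantumEntropy θ t := by
  simp only [quantumEntropy, shannonEntropy_marginalSpectrum₁_kroneckerTensor hs ht,
    shannonEntropy_marginalSpectrum₂_kroneckerTensor hs ht,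
    shannonEntropy_marginalSpectrum₃_kroneckerTensor hs ht]
  ring

end Entropy

/-! ## Super-multiplicativity of the quantum functional (CVZ Thm. 3.19.3) -/

section Functional

variable {ι κ μ ι' κ' μ' : Type*} [Fintype ι] [Fintype κ] [Fintype μ] [Fintype ι'] [Fintype κ']
  [Fintype μ'] [DecidableEq ι] [DecidableEq κ] [DecidableEq μ] [DecidableEq ι'] [DecidableEq κ']
  [DecidableEq μ']

/-- **`E_θ(s) + E_θ(t) ≤ E_θ(s ⊗ t)`** for nonzero `s, t` and `θ ≥ 0` (CVZ, proof of Lemma 3.23: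
`E_θ(s ⊗ t) ≥ H_θ(((A ⊗ A') ⊗ (B ⊗ B') ⊗ (C ⊗ C'))(s ⊗ t))`
`= H_θ((A ⊗ B ⊗ C)s) + H_θ((A' ⊗ B' ⊗ C')t)`, then the supremum over `(A,B,C)` and
`(A',B',C')`). [cite: ChristandlVranaZuiddam2023, Lemma 3.23] -/
theorem logQuantumFunctional_add_le_kroneckerTensor {θ : Fin 3 → ℝ} (hθ : ∀ i, 0 ≤ θ i)
    {s : ι → κ → μ → ℂ} {t : ι' → κ' → μ' → ℂ} (hs : s ≠ 0) (ht : t ≠ 0) :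
    logQuantumFunctional θ s + logQuantumFunctional θ t ≤
      logQuantumFunctional θ (kroneckerTensor s t) := by
  refine ciSup_add_ciSup_le fun g g' => ?_
  have hgs := actTensor_ne_zero_of_ne_zero hs g
  have hgt := actTensor_ne_zero_of_ne_zero ht g'
  rw [← quantumEntropy_kroneckerTensor θ hgs hgt, ← actTensor_kronecker_kroneckerTensor]
  exact quantumEntropy_actTensor_le_logQuantumFunctional hθ (kroneckerTensor s t)
    (Matrix.GeneralLinearGroup.kronecker g.1 g'.1, Matrix.GeneralLinearGroup.kronecker g.2.1 g'.2.1,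
      Matrix.GeneralLinearGroup.kronecker g.2.2 g'.2.2)

/-- **CVZ Thm. 3.19.3 (super-multiplicativity of the quantum functional), `k = 3`**:
`F^θ(s) F^θ(t) ≤ F^θ(s ⊗ t)` for every `θ ∈ P([3])` and all complex 3-tensors `s`, `t`
(`s ⊗ t = kroneckerTensor s t`). This is the `≥` half of `ChristandlVranaZuiddam2023_kronecker`
(Cor. 3.31). [cite: ChristandlVranaZuiddam2023, Thm. 3.19.3] -/
theorem ChristandlVranaZuiddam2023_kronecker_ge (θ : Fin 3 → ℝ) (hθ : θ ∈ stdSimplex ℝ (Fin 3))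
    (s : ι → κ → μ → ℂ) (t : ι' → κ' → μ' → ℂ) :
    quantumFunctional θ s * quantumFunctional θ t ≤ quantumFunctional θ (kroneckerTensor s t) := by
  by_cases hs : s = 0
  · subst hs
    simp
  by_cases ht : t = 0
  · subst ht
    simp
  rw [quantumFunctional_of_ne_zero θ hs, quantumFunctional_of_ne_zero θ ht,
    quantumFunctional_of_ne_zero θ (kroneckerTensor_ne_zero hs ht),
    ← Real.rpow_add (by norm_num : (0 : ℝ) < 2)]
  exact Real.rpow_le_rpow_of_exponent_le one_le_two
    (logQuantumFunctional_add_le_kroneckerTensor (fun i => hθ.1 i) hs ht)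

end Functional

end Literature.Computability.AlgebraicComplexity

end
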